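import Summits.Ventures.Crystal3D.Theorems.StickyWulffConstantCoaxialWallLawEndLawAssemblyOneGrain
import HarnessLib

/-!
# The (F-γ) BI-PLANAR rung of `stub_coaxialTwoSlabAdhesion` modulo ONE planar-heights kissing row

HONEST FRAMING. Part of the venture `Summits/Ventures/Crystal3D` (cell `crystal3d-full`), helper
`--supports` the crux `CoaxialWallLaw` (stmt-Ventures-19481, `route-Ventures-StickyWulffConstant`),
REGISTERED line `WallLedgerF` (planner cf-p1 gen 16), open stub `stub_coaxialTwoSlabAdhesion`.
RUNG CREDIT ONLY; F-C1 not moved.  The (F-γ) case of the planner's ledger (§85(6)(c) (xxix)):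
HEIGHT-INCOMMENSURATE co-axial pairs — in the co-axial frame `L` the basal planes of grain 2 sit at
frame heights `(k + τ)·√(2/3)`, `τ := (L⁻¹(s₂ − s₁))₂ / √(2/3) ∉ ℤ`, strictly between the planes
`k·√(2/3)` of grain 1 (lit's rigid optimum `T*` at `{112}` has `τ = ½`).  The BI-PLANAR class: every
ball of the filling lies on a basal plane of grain 1 OR of grain 2, in-plane positions FREE (it contains
the rigid class `X ⊆ Λ₁ ∪ Λ₂`, hence `T*`, and every in-plane relaxation of it).

The ROW (hypothesis `hrow`, named `BiPlanarEndRow τ` in the companion definitions file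
`…CoaxialWallLawBiPlanarRowDefs`): a set `S` of unit vectors, pairwise `≥ 1` apart, each at frame height
in `√(2/3)·(ℤ ∪ (ℤ + τ))` along a unit axis `m`, containing the in-plane unit vector `−d` but not `d`, has
at most `11` members — the planar-heights kissing row at offset `τ` (a finite spherical-code statement;
numerics of this seat, kit j306954: TRUE for every `τ ∉ ⅓ℤ`, FALSE exactly at `τ ≡ ±⅓` where the inclined
twin dozen is bi-planar; at `τ ∈ ℤ` it is the laminar row of `…LaminarEnd`).

* `biPlanar_card_contacts_le_eleven_of` — under the bi-planar premise, the row at the pair's offset gives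
  `deg e ≤ 11` at every located in-plane run end `e` of grain 1 (`e − d ∈ X`, `e + d ∉ X`).
* **`coaxialTwoSlabAdhesion_biPlanar_of`** — explicit frame, height-incommensurate pair, the row at
  `τ = (L⁻¹(s₂ − s₁))₂/√(2/3)` ⇒ for every BI-PLANAR filling the stub's inequality with constant
  `√6/4 ≈ 0.61 ≥ ½` (one application of `coaxialTwoSlabAdhesion_of_endLaw_oneGrain` with `β ≡ 0`).

WHAT THIS IS NOT: no value of `τ` is discharged here (the row is a finite certificate, memo
F-BIPLANAR-g9.md of the seat); F-C1 not moved.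
-/

noncomputable section

namespace Summit.Ventures.Crystal3D.Theorems

open Summit.Ventures.Crystal3D Finset
open Literature.MathematicalPhysics.StatisticalMechanics (fccStacking barlowStacking IsHaggSeq
  contactDeficiency)
open scoped InnerProductSpace

/-! ## The local law from the row -/

open scoped Classical in
/-- **The bi-planar local law.**  In a filling `X` of the bi-planar class of the frame `(L; s₁, s₂)`
(every ball on a basal plane of grain 1 or of grain 2), a ball `e` on a grain-1 plane with an in-plane
predecessor `e − d ∈ X` and a vacant successor `e + d ∉ X` has at most `11` contacts, provided the
planar-heights kissing row `hrow` holds at the offset `τ`, `(L⁻¹(s₂ − s₁))₂ = τ·√(2/3)`. -/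
theorem biPlanar_card_contacts_le_eleven_of
    (L : EuclideanSpace ℝ (Fin 3) ≃ₗᵢ[ℝ] EuclideanSpace ℝ (Fin 3)) (s₁ s₂ : EuclideanSpace ℝ (Fin 3))
    {τ : ℝ} (hτ : (L.symm (s₂ - s₁)) 2 = τ * Real.sqrt (2 / 3))
    (hrow : (∀ (m d : EuclideanSpace ℝ (Fin 3)) (S : Finset (EuclideanSpace ℝ (Fin 3))),
      ‖m‖ = 1 → ‖d‖ = 1 → ⟪d, m⟫_ℝ = 0 →
      (∀ v ∈ S, ‖v‖ = 1) →
      (∀ v ∈ S, ∃ k : ℤ, ⟪v, m⟫_ℝ = k * Real.sqrt (2 / 3) ∨ ⟪v, m⟫_ℝ = (k + τ) * Real.sqrt (2 / 3)) →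
      (∀ v ∈ S, ∀ w ∈ S, v ≠ w → 1 ≤ dist v w) →
      -d ∈ S → d ∉ S → S.card ≤ 11))
    (X : Finset (EuclideanSpace ℝ (Fin 3)))
    (hX : ∀ p ∈ X, ∀ q ∈ X, p ≠ q → 1 ≤ dist p q)
    (hbi : ∀ p ∈ X, (∃ k : ℤ, (L.symm (p - s₁)) 2 = k * Real.sqrt (2 / 3)) ∨
      (∃ k : ℤ, (L.symm (p - s₂)) 2 = k * Real.sqrt (2 / 3)))
    {e : EuclideanSpace ℝ (Fin 3)} {ke : ℤ} (hek : (L.symm (e - s₁)) 2 = ke * Real.sqrt (2 / 3))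
    {d : EuclideanSpace ℝ (Fin 3)} (hd : ‖d‖ = 1)
    (hdm : ⟪d, L (EuclideanSpace.single (2 : Fin 3) (1 : ℝ))⟫_ℝ = 0)
    (hpred : e - d ∈ X) (hsucc : e + d ∉ X) :
    (X.filter fun q => dist e q = 1).card ≤ 11 := by
  set e₃ : EuclideanSpace ℝ (Fin 3) := EuclideanSpace.single (2 : Fin 3) (1 : ℝ) with he₃
  set m : EuclideanSpace ℝ (Fin 3) := L e₃ with hm
  set C : Finset (EuclideanSpace ℝ (Fin 3)) := X.filter fun q => dist e q = 1 with hC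
  set S : Finset (EuclideanSpace ℝ (Fin 3)) := C.image fun q => q - e with hS
  have he₃1 : ‖e₃‖ = 1 := by rw [he₃, PiLp.norm_single, norm_one]
  have hm1 : ‖m‖ = 1 := by rw [hm, LinearIsometryEquiv.norm_map, he₃1]
  -- the frame height of a contact relative to `e`
  have hheight : ∀ q : EuclideanSpace ℝ (Fin 3), ⟪q - e, m⟫_ℝ = (L.symm (q - s₁)) 2 - (L.symm (e - s₁)) 2 := by
    intro q
    have hq : q - e = L (L.symm (q - s₁) - L.symm (e - s₁)) := by
      rw [map_sub, LinearIsometryEquiv.apply_symm_apply, LinearIsometryEquiv.apply_symm_apply]; abel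
    rw [hq, hm, LinearIsometryEquiv.inner_map_map, EuclideanSpace.inner_single_right, PiLp.sub_apply]
    simp
  have hinj : Set.InjOn (fun q : EuclideanSpace ℝ (Fin 3) => q - e) C := fun a _ b _ h => sub_left_injective h
  have hcard : S.card = C.card := card_image_of_injOn hinj
  rw [← hcard]
  refine hrow m d S hm1 hd (by rw [hm]; exact hdm) ?_ ?_ ?_ ?_ ?_
  · -- unit members
    intro v hv
    obtain ⟨q, hq, rfl⟩ := mem_image.1 hv
    rw [hC, mem_filter] at hq
    rw [← dist_eq_norm, dist_comm, hq.2]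
  · -- heights
    intro v hv
    obtain ⟨q, hq, rfl⟩ := mem_image.1 hv
    rw [hC, mem_filter] at hq
    rcases hbi q hq.1 with ⟨k, hk⟩ | ⟨k, hk⟩
    · exact ⟨k - ke, Or.inl (by rw [hheight, hk, hek]; push_cast; ring)⟩
    · refine ⟨k - ke, Or.inr ?_⟩
      have hsplit : L.symm (q - s₁) = L.symm (q - s₂) + L.symm (s₂ - s₁) := by
        rw [← map_add]; congr 1; abel
      rw [hheight, hsplit, PiLp.add_apply, hk, hτ, hek]; push_cast; ring
  · -- pairwise separation
    intro v hv w hw hvw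
    obtain ⟨q, hq, rfl⟩ := mem_image.1 hv
    obtain ⟨q', hq', rfl⟩ := mem_image.1 hw
    rw [hC, mem_filter] at hq hq'
    have hne : q ≠ q' := fun h => hvw (by rw [h])
    have h1 := hX q hq.1 q' hq'.1 hne
    rw [dist_eq_norm] at h1
    rw [dist_eq_norm, sub_sub_sub_cancel_right]
    exact h1
  · -- the predecessor
    refine mem_image.2 ⟨e - d, ?_, by abel⟩
    rw [hC, mem_filter]
    refine ⟨hpred, ?_⟩
    rw [dist_eq_norm, sub_sub_cancel, hd]
  · -- the vacant successor
    intro hdS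
    obtain ⟨q, hq, hqe⟩ := mem_image.1 hdS
    rw [hC, mem_filter] at hq
    have : q = e + d := by rw [← hqe]; abel
    exact hsucc (this ▸ hq.1)

/-! ## The rung -/

open scoped Classical in
/-- **The (F-γ) bi-planar rung of `stub_coaxialTwoSlabAdhesion` modulo the row** (explicit frame,
height-incommensurate pair, constant `√6/4`): if the planar-heights kissing row `hrow` holds at the
pair's offset `τ = (L⁻¹(s₂ − s₁))₂/√(2/3)`, then every BI-PLANAR filling (every ball on a basal plane of
grain 1 or of grain 2, in-plane positions free) satisfies
`cross ≤ D(Y) + (φ₁ + φ₂ − (√6/4)·sin θ)πρ² + C(1+h)ρ`. -/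
theorem coaxialTwoSlabAdhesion_biPlanar_of
    (A₁ : EuclideanSpace ℝ (Fin 3) ≃ₗᵢ[ℝ] EuclideanSpace ℝ (Fin 3)) (t₁ : EuclideanSpace ℝ (Fin 3))
    (A₂ : EuclideanSpace ℝ (Fin 3) ≃ₗᵢ[ℝ] EuclideanSpace ℝ (Fin 3)) (t₂ : EuclideanSpace ℝ (Fin 3))
    (L : EuclideanSpace ℝ (Fin 3) ≃ₗᵢ[ℝ] EuclideanSpace ℝ (Fin 3)) (s₁ s₂ : EuclideanSpace ℝ (Fin 3))
    {σ σ' : ℤ → ℤ} (hσ : IsHaggSeq σ) (hσ' : IsHaggSeq σ')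
    (hsub₁ : (fun p => A₁ p + t₁) '' fccStacking 1 (Real.sqrt (2 / 3)) ⊆
      (fun p => L p + s₁) '' barlowStacking 1 (Real.sqrt (2 / 3)) σ)
    (hsub₂ : (fun p => A₂ p + t₂) '' fccStacking 1 (Real.sqrt (2 / 3)) ⊆
      (fun p => L p + s₂) '' barlowStacking 1 (Real.sqrt (2 / 3)) σ')
    (hinc : ¬ ∃ k₀ : ℤ, (L.symm (s₂ - s₁)) 2 = k₀ * Real.sqrt (2 / 3)) {τ : ℝ}
    (hτ : (L.symm (s₂ - s₁)) 2 = τ * Real.sqrt (2 / 3))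
    (hrow : (∀ (m d : EuclideanSpace ℝ (Fin 3)) (S : Finset (EuclideanSpace ℝ (Fin 3))),
      ‖m‖ = 1 → ‖d‖ = 1 → ⟪d, m⟫_ℝ = 0 →
      (∀ v ∈ S, ‖v‖ = 1) →
      (∀ v ∈ S, ∃ k : ℤ, ⟪v, m⟫_ℝ = k * Real.sqrt (2 / 3) ∨ ⟪v, m⟫_ℝ = (k + τ) * Real.sqrt (2 / 3)) →
      (∀ v ∈ S, ∀ w ∈ S, v ≠ w → 1 ≤ dist v w) →
      -d ∈ S → d ∉ S → S.card ≤ 11)) :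
    ∃ C : ℝ, ∀ h : ℝ, 0 ≤ h → ∀ ρ : ℝ, 10 ≤ ρ →
      ∀ X P₁ P₂ : Finset (EuclideanSpace ℝ (Fin 3)),
      (∀ p ∈ X, ∀ q ∈ X, p ≠ q → 1 ≤ dist p q) → P₁ ⊆ X → P₂ ⊆ X \ P₁ →
      (∀ p ∈ X, -(2 * 10) ≤ p 2 ∧ p 2 ≤ h + 2 * 10 ∧ p 0 ^ 2 + p 1 ^ 2 ≤ ρ ^ 2) →
      (∀ p, p ∈ P₁ ↔ (p ∈ (fun q => A₁ q + t₁) '' fccStacking 1 (Real.sqrt (2 / 3)) ∧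
        -(2 * 10) ≤ p 2 ∧ p 2 ≤ -10 ∧ p 0 ^ 2 + p 1 ^ 2 ≤ ρ ^ 2)) →
      (∀ p, p ∈ P₂ ↔ (p ∈ (fun q => A₂ q + t₂) '' fccStacking 1 (Real.sqrt (2 / 3)) ∧
        h + 10 ≤ p 2 ∧ p 2 ≤ h + 2 * 10 ∧ p 0 ^ 2 + p 1 ^ 2 ≤ ρ ^ 2)) →
      (∀ p ∈ X, (∃ k : ℤ, (L.symm (p - s₁)) 2 = k * Real.sqrt (2 / 3)) ∨
        (∃ k : ℤ, (L.symm (p - s₂)) 2 = k * Real.sqrt (2 / 3))) →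
      ((((P₁ ×ˢ (X \ P₁)).filter fun pq => dist pq.1 pq.2 = 1).card : ℕ) : ℝ) +
        ((((P₂ ×ˢ ((X \ P₁) \ P₂)).filter fun pq => dist pq.1 pq.2 = 1).card : ℕ) : ℝ) ≤
        contactDeficiency ((X \ P₁) \ P₂) +
          (Real.sqrt 2 / 4 * ∑ᶠ w ∈ {w ∈ fccStacking 1 (Real.sqrt (2 / 3)) | ‖w‖ = 1},
              |⟪w, A₁.symm (EuclideanSpace.single (2 : Fin 3) (1 : ℝ))⟫_ℝ| +
            Real.sqrt 2 / 4 * ∑ᶠ w ∈ {w ∈ fccStacking 1 (Real.sqrt (2 / 3)) | ‖w‖ = 1},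
              |⟪w, A₂.symm (EuclideanSpace.single (2 : Fin 3) (1 : ℝ))⟫_ℝ| -
            (Real.sqrt 6 / 4 : ℝ) * Real.sqrt (1 - ⟪L (EuclideanSpace.single (2 : Fin 3) (1 : ℝ)),
              (EuclideanSpace.single (2 : Fin 3) (1 : ℝ))⟫_ℝ ^ 2)) * Real.pi * ρ ^ 2 +
          C * (1 + h) * ρ := by
  have hdisj := coaxial_disjoint_of_heightIncompat A₁ t₁ A₂ t₂ L s₁ s₂ hsub₁ hsub₂ hinc
  obtain ⟨C, hC⟩ := coaxialTwoSlabAdhesion_of_endLaw_oneGrain A₁ t₁ A₂ t₂ L s₁ s₂ hσ hσ' hsub₁ hsub₂ hdisj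
  refine ⟨C, ?_⟩
  intro h hh ρ hρ X P₁ P₂ hX hP₁X hP₂X hcell hP₁ hP₂ hbi
  -- the local law with budget `β ≡ 0`
  have hlaw := hC h hh ρ hρ X P₁ P₂ hX hP₁X hP₂X hcell hP₁ hP₂ (fun _ => 0) (fun _ => le_rfl) (by
    intro e he w hw hwn heΛ hpred hsucc _
    obtain ⟨ke, hke⟩ := onPlane_of_mem_coaxialGrain A₁ t₁ L s₁ hsub₁ heΛ
    have hd : ‖A₁ w‖ = 1 := by rw [LinearIsometryEquiv.norm_map, norm_eq_one_of_mem_fccSlots hw]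
    have hle := biPlanar_card_contacts_le_eleven_of L s₁ s₂ hτ hrow X hX hbi hke hd hwn hpred hsucc
    have : ((X.filter fun q => dist e q = 1).card : ℝ) ≤ 11 := by exact_mod_cast hle
    linarith)
  simp only [sum_const_zero, mul_zero, add_zero] at hlaw
  exact hlaw

end Summit.Ventures.Crystal3D.Theorems

end
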